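import Mathlib
import Summits.Ventures.PercRepro2.Defs
import Summits.Ventures.PercRepro2.Harris
import Summits.Ventures.PercRepro2.Graph
import Summits.Ventures.PercRepro2.Events
import Summits.Ventures.PercRepro2.Induced
import Summits.Ventures.PercRepro2.BHKEvents
import Summits.Ventures.PercRepro2.BHKOutside

/-!
# The mixed three-point inequality from contain-weighted positive association
(blind cell PercRepro2, p2; proofs/P2-G14-PAIRSPLIT.md §3–§4)

Conditionally on `Q = {s ↮ t}`, for vertices `b, x` (read against the cluster of `t`) and `y`
(read against the cluster of `s`), the MIXED THREE-POINT INEQUALITY (★) is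

  `P(b ∈ C_t, x ∈ C_t, y ∈ C_s, Q)·P(Q)² + P(b ∈ C_t, Q)·P(x ∈ C_t, Q)·P(y ∈ C_s, Q)
      ≥ P(b ∈ C_t, Q)·P(x ∈ C_t, y ∈ C_s, Q)·P(Q) + P(x ∈ C_t, Q)·P(b ∈ C_t, y ∈ C_s, Q)·P(Q)`,

i.e. `Cov_μ(1[b ∈ C_t], 1[y ∈ C_s]·(1[x ∈ C_t] − μ(x ∈ C_t))) ≥ 0` under `μ = P(· | Q)` — the half
(I5) of the pair form of the cell's row 2′BETA1 line (with `(x, y) = (o, u)`).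

Exploring `C_s = W` first (`prob_clusterIn_inter_eq_expect`), the events of `C_t` become the
functionals `g_b(W) = P_{G∖W}(b ∈ C_t)`, `g_x(W) = P_{G∖W}(x ∈ C_t)` (`delClusterProb`), and
Harris on `G ∖ W` gives `P_{G∖W}(b, x ∈ C_t) ≥ g_b(W)·g_x(W)` (`delClusterProb_inter_ge_mul`, from BHKOutside's `delClusterProb_mul_le`), so
(★) follows from the CONTAIN-WEIGHTED positive association of the pair `(g_b, g_x)` under the
law of `C_s` given `Q`, with the weight `1[y ∈ C_s]`:

  (B★)  `E_ν[1[y ∈ C_s]·(g_b − E_ν g_b)·(g_x − E_ν g_x)] ≥ 0`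

(multiplied out, the hypothesis `hB` of `mixed_three_point_of_contain_weighted`). (B★) is the one
open statement of the line (census-true for arbitrary antitone functionals; P2-G14-PAIRSPLIT §5);
this file records the reduction (★) ⟸ (B★) in the kernel.
-/

namespace Summit.Ventures.PercRepro2

section MixedThreePoint

variable {V : Type*} {E : Type*} [Fintype E] [DecidableEq E] [Fintype V] [DecidableEq V]
  {R : Type*} [CommRing R] [LinearOrder R] [IsStrictOrderedRing R]

omit [Fintype V] [DecidableEq V] in
/-- **Harris on `G ∖ W`** for the explored-cluster functionals of one vertex (the `u = v` case of
`delClusterProb_mul_le`, BHKOutside.lean): for up-sets `𝓤, 𝓥`,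
`P_{G∖W}(C_t ∈ 𝓤)·P_{G∖W}(C_t ∈ 𝓥) ≤ P_{G∖W}(C_t ∈ 𝓤 ∩ 𝓥)`. -/
lemma delClusterProb_inter_ge_mul (p : E → R) (hp : IsProbVec p) (ends : E → Sym2 V) (t : V)
    {𝓤 𝓥 : Set (Set V)} (h𝓤 : IsUpperSet 𝓤) (h𝓥 : IsUpperSet 𝓥) (W : Set V) :
    delClusterProb p ends t 𝓤 W * delClusterProb p ends t 𝓥 W ≤
      delClusterProb p ends t (𝓤 ∩ 𝓥) W := by
  have e : {ω : Config E | cluster ends (delConfig ends W ω) t ∈ 𝓤 ∩ 𝓥} =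
      {ω : Config E | cluster ends (delConfig ends W ω) t ∈ 𝓤} ∩
        {ω : Config E | cluster ends (delConfig ends W ω) t ∈ 𝓥} := by
    ext ω
    simp only [Set.mem_setOf_eq, Set.mem_inter_iff]
  unfold delClusterProb
  rw [e]
  exact delClusterProb_mul_le hp ends t t h𝓤 h𝓥 W

omit [DecidableEq V] [LinearOrder R] [IsStrictOrderedRing R] in
/-- The tower identity with the trivial family on `C_s`: `P(C_t ∈ 𝓥, s ↮ t) = E[g(C_s) 1_{s↮t}]`. -/
lemma prob_clusterIn_inter_eq_expect_univ (p : E → R) (ends : E → Sym2 V) (s t : V)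
    (𝓥 : Set (Set V)) :
    prob p (clusterInEvent ends t 𝓥 ∩ (connEvent ends s t)ᶜ) =
      expect p (fun ω => delClusterProb p ends t 𝓥 (cluster ends ω s) *
        ((connEvent ends s t)ᶜ).indicator 1 ω) := by
  have eV := prob_clusterIn_inter_eq_expect p ends s t Set.univ 𝓥
  simp only [Set.indicator_univ, Pi.one_apply, one_mul] at eV
  have eV' : clusterInEvent ends s Set.univ ∩ clusterInEvent ends t 𝓥 ∩ (connEvent ends s t)ᶜ =
      clusterInEvent ends t 𝓥 ∩ (connEvent ends s t)ᶜ := by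
    ext ω; simp [clusterInEvent]
  rw [eV'] at eV
  exact eV

omit [DecidableEq V] in
/-- **The mixed three-point inequality (★) from contain-weighted positive association.** With
`Q = {s ↮ t}`, `Y = {y ∈ C_s}`, `B = {b ∈ C_t}`, `X = {x ∈ C_t}`, and the explored-cluster
functionals `g_b = delClusterProb p ends t {b ∈ ·}`, `g_x = delClusterProb p ends t {x ∈ ·}`:
the hypothesis `hB` is (B★) for the pair `(g_b, g_x)` with the weight `1_Y`, multiplied out,

  `E[g_b 1_Q]·E[1_Y g_x 1_Q]·P(Q) + E[g_x 1_Q]·E[1_Y g_b 1_Q]·P(Q)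
      ≤ E[1_Y g_b g_x 1_Q]·P(Q)² + E[g_b 1_Q]·E[g_x 1_Q]·P(Y, Q)`,

and the conclusion is (★):

  `P(B, Q)·P(Y, X, Q)·P(Q) + P(X, Q)·P(Y, B, Q)·P(Q) ≤ P(Y, B, X, Q)·P(Q)² + P(B, Q)·P(X, Q)·P(Y, Q)`. -/
theorem mixed_three_point_of_contain_weighted (p : E → R) (hp : IsProbVec p) (ends : E → Sym2 V)
    (s t b x y : V)
    (hB : expect p (fun ω => delClusterProb p ends t {W : Set V | b ∈ W} (cluster ends ω s) *
            ((connEvent ends s t)ᶜ).indicator 1 ω) *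
          expect p (fun ω => ({W : Set V | y ∈ W} : Set (Set V)).indicator 1 (cluster ends ω s) *
            delClusterProb p ends t {W : Set V | x ∈ W} (cluster ends ω s) *
            ((connEvent ends s t)ᶜ).indicator 1 ω) *
          prob p (connEvent ends s t)ᶜ +
        expect p (fun ω => delClusterProb p ends t {W : Set V | x ∈ W} (cluster ends ω s) *
            ((connEvent ends s t)ᶜ).indicator 1 ω) *
          expect p (fun ω => ({W : Set V | y ∈ W} : Set (Set V)).indicator 1 (cluster ends ω s) *
            delClusterProb p ends t {W : Set V | b ∈ W} (cluster ends ω s) *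
            ((connEvent ends s t)ᶜ).indicator 1 ω) *
          prob p (connEvent ends s t)ᶜ ≤
      expect p (fun ω => ({W : Set V | y ∈ W} : Set (Set V)).indicator 1 (cluster ends ω s) *
            (delClusterProb p ends t {W : Set V | b ∈ W} (cluster ends ω s) *
              delClusterProb p ends t {W : Set V | x ∈ W} (cluster ends ω s)) *
            ((connEvent ends s t)ᶜ).indicator 1 ω) *
          prob p (connEvent ends s t)ᶜ * prob p (connEvent ends s t)ᶜ +
        expect p (fun ω => delClusterProb p ends t {W : Set V | b ∈ W} (cluster ends ω s) *
            ((connEvent ends s t)ᶜ).indicator 1 ω) *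
          expect p (fun ω => delClusterProb p ends t {W : Set V | x ∈ W} (cluster ends ω s) *
            ((connEvent ends s t)ᶜ).indicator 1 ω) *
          prob p (clusterInEvent ends s {W : Set V | y ∈ W} ∩ (connEvent ends s t)ᶜ)) :
    prob p (clusterInEvent ends t {W : Set V | b ∈ W} ∩ (connEvent ends s t)ᶜ) *
          prob p (clusterInEvent ends s {W : Set V | y ∈ W} ∩
            clusterInEvent ends t {W : Set V | x ∈ W} ∩ (connEvent ends s t)ᶜ) *
          prob p (connEvent ends s t)ᶜ +
        prob p (clusterInEvent ends t {W : Set V | x ∈ W} ∩ (connEvent ends s t)ᶜ) *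
          prob p (clusterInEvent ends s {W : Set V | y ∈ W} ∩
            clusterInEvent ends t {W : Set V | b ∈ W} ∩ (connEvent ends s t)ᶜ) *
          prob p (connEvent ends s t)ᶜ ≤
      prob p (clusterInEvent ends s {W : Set V | y ∈ W} ∩
            clusterInEvent ends t {W : Set V | b ∈ W ∧ x ∈ W} ∩ (connEvent ends s t)ᶜ) *
          prob p (connEvent ends s t)ᶜ * prob p (connEvent ends s t)ᶜ +
        prob p (clusterInEvent ends t {W : Set V | b ∈ W} ∩ (connEvent ends s t)ᶜ) *
          prob p (clusterInEvent ends t {W : Set V | x ∈ W} ∩ (connEvent ends s t)ᶜ) *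
          prob p (clusterInEvent ends s {W : Set V | y ∈ W} ∩ (connEvent ends s t)ᶜ) := by
  classical
  -- the tower identities
  have T1 := prob_clusterIn_inter_eq_expect p ends s t {W : Set V | y ∈ W}
    ({W : Set V | b ∈ W} ∩ {W : Set V | x ∈ W})
  have eBX : ({W : Set V | b ∈ W} ∩ {W : Set V | x ∈ W}) = {W : Set V | b ∈ W ∧ x ∈ W} := by
    ext W; simp only [Set.mem_inter_iff, Set.mem_setOf_eq]
  have T2 := prob_clusterIn_inter_eq_expect p ends s t {W : Set V | y ∈ W} {W : Set V | b ∈ W}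
  have T2' := prob_clusterIn_inter_eq_expect p ends s t {W : Set V | y ∈ W} {W : Set V | x ∈ W}
  have T3 := prob_clusterIn_inter_eq_expect_univ p ends s t {W : Set V | b ∈ W}
  have T3' := prob_clusterIn_inter_eq_expect_univ p ends s t {W : Set V | x ∈ W}
  -- Harris on `G ∖ W`, pointwise, then under the expectation
  have hup : ∀ v : V, IsUpperSet {W : Set V | v ∈ W} := fun _ _ _ h hv => h hv
  have hH : expect p (fun ω => ({W : Set V | y ∈ W} : Set (Set V)).indicator 1 (cluster ends ω s) *
        (delClusterProb p ends t {W : Set V | b ∈ W} (cluster ends ω s) *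
          delClusterProb p ends t {W : Set V | x ∈ W} (cluster ends ω s)) *
        ((connEvent ends s t)ᶜ).indicator 1 ω) ≤
      expect p (fun ω => ({W : Set V | y ∈ W} : Set (Set V)).indicator 1 (cluster ends ω s) *
        delClusterProb p ends t ({W : Set V | b ∈ W} ∩ {W : Set V | x ∈ W}) (cluster ends ω s) *
        ((connEvent ends s t)ᶜ).indicator 1 ω) := by
    apply expect_mono hp
    intro ω
    have h1 : (0 : R) ≤ ({W : Set V | y ∈ W} : Set (Set V)).indicator 1 (cluster ends ω s) :=
      Set.indicator_apply_nonneg fun _ => zero_le_one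
    have h2 : (0 : R) ≤ ((connEvent ends s t)ᶜ).indicator 1 ω :=
      Set.indicator_apply_nonneg fun _ => zero_le_one
    have h3 := delClusterProb_inter_ge_mul p hp ends t (hup b) (hup x) (cluster ends ω s)
    exact mul_le_mul_of_nonneg_right (mul_le_mul_of_nonneg_left h3 h1) h2
  rw [eBX] at T1 hH
  rw [T1, T2, T2', T3, T3']
  have hQ : 0 ≤ prob p (connEvent ends s t)ᶜ := prob_nonneg hp _
  have hQQ : 0 ≤ prob p (connEvent ends s t)ᶜ * prob p (connEvent ends s t)ᶜ := mul_nonneg hQ hQ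
  have hH' := mul_le_mul_of_nonneg_right hH hQQ
  -- `hB` plus Harris
  linarith [hB, hH']

end MixedThreePoint

end Summit.Ventures.PercRepro2
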